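import Mathlib.Analysis.SpecialFunctions.Log.Basic
import Mathlib.Algebra.Order.BigOperators.Group.Finset
import Mathlib.Algebra.BigOperators.Intervals
import Mathlib.Algebra.BigOperators.Field
import Literature.NumberTheory.LFunctions.EulerProductAtOne
import HarnessLib

/-!
# TWO-LOOP DISCRETE FLOW with summable remainder from a LARGE datum: the endpoint arithmetic (part 1 of the FLOW JUNCTION for crux
# `TwistedTraceScaling`, stmt-QuantumFields-20203, line «twolattice», stub TOWER-E1; RG plan `RG-PLAN-20203-towerE1.md` §2 (S2) / §3 (FLOW))

Route `LuscherReduction` (owner ym-beyond-p1), LEAD ym-lead-20203-twolattice g1.  The plan's FLOW module asks of Bałaban's effective couplings `g_j` along the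
blockings `L → … → b` (block factor `M`, `K` steps) the TWO-LOOP DISCRETE FLOW with a uniformly summable remainder

  `x_j − x_{j+1} = a + κ·a/x_j + e_j`,  `x_j = 1/g_j²`,  `a = 2b₀ log M`,  `κ = b₁/b₀`,  `Σ_{j<K} |e_j| ≤ R`   (TL)

(nothing of the kind is in print for the lattice: [Balaban1987RG1] Thm 2 (0.31) p.259 is stated without proof and is a one-loop sandwich; the shape is Rivasseau's
Lemma II.5.4, whose arithmetic for an `O(1)` initial datum is the tree's `Literature/…/AsymptoticFreedomDiscreteFlow`).  THIS FILE proves, for ABSTRACT real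
sequences (no RG object is defined or assumed to exist), the large-datum endpoint arithmetic:

* (§0: the elementary `|−log(1−u) − u| ≤ 2u²` on `|u| ≤ 1/2` is REUSED from the tree, `Literature.NumberTheory.LFunctions.EulerProductOne.abs_neg_log_one_sub_sub_le`.)
* §1 `inv_sq_sum_le` — with one-sided decrements `x_j − x_{j+1} ≥ a − r_j` and a floor `x_j ≥ m > 0`: `Σ_{j<K} 1/x_j² ≤ (1/m + 2R/m²)/a` (telescoping `1/x`).
* §2 `abs_log_ratio_sub_sum_le` — `|log(x_0/x_K) − Σ_{j<K} a/x_j| ≤ C₂ := (κa + m²/2)(1/m + 2R/m²)/a + R/m` (telescoping `log x`).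
* §3 ★ `twoLoopFlow_endpoint` — `|x_K − (x_0 − aK − κ log(x_0/x_K))| ≤ κ·C₂ + R`: the endpoint of a two-loop flow is the one-loop line corrected by
  `κ log(x_0/x_K)`, up to `O(1)` UNIFORMLY IN `K` and in the (large) datum `x_0`.
The junction with the tree's label `invRunningCoupling` (the cancellation of the label's `(b₁/b₀) log(2b₀/β)` against the flow's two-loop sum, and
`x_K·Λ³ → 1`) is the companion module `…TwistedTraceScalingFlowJunction`.

HONEST FRAMING: elementary real analysis about hypothetical sequences; the existence of Bałaban's effective couplings satisfying (TL) on the femto tori is the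
OPEN FLOW module (XXL, not in print); femto rung R2b1 of a CONDITIONAL reduction route; nothing here is a claim about Yang–Mills, a gap, or Clay.
No definitions, no new named facts.  Route- and cone-free imports (Mathlib + one Literature lemma).
-/

set_option autoImplicit false

noncomputable section

open Real
open scoped BigOperators

namespace Summit.QuantumFields.YangMills.Theorems.FemtoTransferGap.TwoLattice

namespace TowerFlow

/-! ## §1 The sum of `1/x_j²` along a flow with decrements `≥ a − r_j` -/

/-- One step: if `x − x' ≥ a − r` with `x, x' ≥ m > 0`, `a > 0`, `r ≥ 0`, then `a/x² ≤ (1/x' − 1/x) + 2r/m²`. [folklore] -/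
theorem inv_sq_step {a m r x x' : ℝ} (ha : 0 < a) (hm : 0 < m) (hr : 0 ≤ r) (hx : m ≤ x) (hx' : m ≤ x')
    (hd : a - r ≤ x - x') : a / x ^ 2 ≤ (1 / x' - 1 / x) + 2 * r / m ^ 2 := by
  have hxpos : 0 < x := lt_of_lt_of_le hm hx
  have hx'pos : 0 < x' := lt_of_lt_of_le hm hx'
  have hm2 : 0 < m ^ 2 := by positivity
  by_cases hd0 : 0 ≤ x - x'
  · -- `x' ≤ x`: `a/x² ≤ a/(x x') = (d + (a-d))/(x x') ≤ (1/x' − 1/x) + r/(x x') ≤ … + r/m²`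
    have hxx' : 0 < x * x' := by positivity
    have h1 : a / x ^ 2 ≤ a / (x * x') := by
      apply div_le_div_of_nonneg_left ha.le hxx'
      nlinarith
    have h2 : a / (x * x') ≤ (x - x') / (x * x') + r / (x * x') := by
      rw [← add_div]; exact div_le_div_of_nonneg_right (by linarith) hxx'.le
    have h3 : (x - x') / (x * x') = 1 / x' - 1 / x := by field_simp
    have h4 : r / (x * x') ≤ r / m ^ 2 := by
      apply div_le_div_of_nonneg_left hr hm2
      nlinarith [mul_le_mul hx hx' hm.le hxpos.le]
    have h5 : r / m ^ 2 ≤ 2 * r / m ^ 2 := by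
      rw [div_le_div_iff_of_pos_right hm2]; linarith
    linarith
  · -- `x < x'`: then `a < r`, so `a/x² ≤ a/m² ≤ r/m²`, and `1/x' − 1/x ≥ −r/m²`
    rw [not_le] at hd0
    have har : a ≤ r := by linarith
    have h1 : a / x ^ 2 ≤ r / m ^ 2 := by
      calc a / x ^ 2 ≤ a / m ^ 2 := by
            apply div_le_div_of_nonneg_left ha.le hm2; nlinarith
        _ ≤ r / m ^ 2 := div_le_div_of_nonneg_right har hm2.le
    have hxx' : 0 < x * x' := by positivity
    have h2 : -(r / m ^ 2) ≤ 1 / x' - 1 / x := by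
      have h3 : 1 / x' - 1 / x = (x - x') / (x * x') := by field_simp
      rw [h3, le_div_iff₀ hxx', neg_mul]
      have h4 : r / m ^ 2 * (x * x') ≥ r := by
        have : m ^ 2 ≤ x * x' := by nlinarith [mul_le_mul hx hx' hm.le hxpos.le]
        calc r / m ^ 2 * (x * x') ≥ r / m ^ 2 * m ^ 2 := by
              exact mul_le_mul_of_nonneg_left this (div_nonneg hr hm2.le)
          _ = r := by field_simp
      linarith
    have : r / m ^ 2 + r / m ^ 2 = 2 * r / m ^ 2 := by ring
    linarith

/-- ★ §1 **`Σ_{j<K} 1/x_j² ≤ (1/m + 2R/m²)/a`** along a flow with decrements `x_j − x_{j+1} ≥ a − r_j`, `Σ r_j ≤ R`, floor `x_j ≥ m > 0`. [folklore] -/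
theorem inv_sq_sum_le {x r : ℕ → ℝ} {a m R : ℝ} {K : ℕ} (ha : 0 < a) (hm : 0 < m)
    (hr : ∀ j, j < K → 0 ≤ r j) (hR : ∑ j ∈ Finset.range K, r j ≤ R)
    (hx : ∀ j, j ≤ K → m ≤ x j) (hd : ∀ j, j < K → a - r j ≤ x j - x (j + 1)) :
    ∑ j ∈ Finset.range K, 1 / x j ^ 2 ≤ (1 / m + 2 * R / m ^ 2) / a := by
  have hstep : ∀ j ∈ Finset.range K, a / x j ^ 2 ≤ (1 / x (j + 1) - 1 / x j) + 2 * r j / m ^ 2 := by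
    intro j hj
    have hj' := Finset.mem_range.1 hj
    exact inv_sq_step ha hm (hr j hj') (hx j hj'.le) (hx (j + 1) hj') (hd j hj')
  have hsum := Finset.sum_le_sum hstep
  rw [Finset.sum_add_distrib, Finset.sum_range_sub (f := fun j => 1 / x j)] at hsum
  have hK0 : m ≤ x K := hx K le_rfl
  have hx0 : m ≤ x 0 := hx 0 (Nat.zero_le _)
  have h1 : 1 / x K ≤ 1 / m := by
    apply div_le_div_of_nonneg_left zero_le_one hm hK0
  have h2 : 0 ≤ 1 / x 0 := by
    have : 0 < x 0 := lt_of_lt_of_le hm hx0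
    positivity
  have h3 : ∑ j ∈ Finset.range K, 2 * r j / m ^ 2 = 2 * (∑ j ∈ Finset.range K, r j) / m ^ 2 := by
    rw [Finset.mul_sum, Finset.sum_div]
  have hm2 : 0 < m ^ 2 := by positivity
  have h4 : 2 * (∑ j ∈ Finset.range K, r j) / m ^ 2 ≤ 2 * R / m ^ 2 := by
    rw [div_le_div_iff_of_pos_right hm2]; linarith
  have hlhs : ∑ j ∈ Finset.range K, a / x j ^ 2 = a * ∑ j ∈ Finset.range K, 1 / x j ^ 2 := by
    rw [Finset.mul_sum]; refine Finset.sum_congr rfl fun j _ => ?_; ring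
  rw [le_div_iff₀ ha, mul_comm]
  rw [hlhs] at hsum
  linarith

/-! ## §2 The Riemann sum `Σ a/x_j` against `log(x_0/x_K)` -/

/-- One step of the two-loop flow: with `|x − x' − (a + κa/x)| ≤ r`, floor `m ≤ x, x'` (`m ≥ 1`) and `a + κa + r ≤ m/2`:
`|log x − log x' − a/x| ≤ (κa + m²/2)/x² + r/m`. [folklore] -/
theorem log_step {a κ m r x x' : ℝ} (ha : 0 < a) (hκ : 0 ≤ κ) (hm : 1 ≤ m) (hr : 0 ≤ r) (hx : m ≤ x) (hx' : m ≤ x')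
    (hsmall : a + κ * a + r ≤ m / 2) (hd : |x - x' - (a + κ * a / x)| ≤ r) :
    |Real.log x - Real.log x' - a / x| ≤ (κ * a + m ^ 2 / 2) / x ^ 2 + r / m := by
  have hmpos : 0 < m := by linarith
  have hxpos : 0 < x := lt_of_lt_of_le hmpos hx
  have hx'pos : 0 < x' := lt_of_lt_of_le hmpos hx'
  have hx1 : 1 ≤ x := hm.trans hx
  -- the relative decrement `u = (x - x')/x`, `x' = x (1 - u)`
  set d : ℝ := x - x' with hd_def
  set u : ℝ := d / x with hu_def
  have hκax : κ * a / x ≤ κ * a := by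
    rw [div_le_iff₀ hxpos]
    have : 0 ≤ κ * a := by positivity
    nlinarith
  have hκax0 : 0 ≤ κ * a / x := by positivity
  have hdabs : |d| ≤ m / 2 := by
    have h1 : |d| ≤ |d - (a + κ * a / x)| + |a + κ * a / x| := by
      have := abs_add_le (d - (a + κ * a / x)) (a + κ * a / x); rwa [sub_add_cancel] at this
    have h2 : |a + κ * a / x| = a + κ * a / x := abs_of_pos (by positivity)
    rw [h2] at h1
    linarith
  have huabs : |u| ≤ 1 / 2 := by
    rw [hu_def, abs_div, abs_of_pos hxpos, div_le_iff₀ hxpos]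
    calc |d| ≤ m / 2 := hdabs
      _ ≤ 1 / 2 * x := by linarith
  have hx'eq : x' = x * (1 - u) := by
    rw [hu_def, hd_def]; field_simp; ring
  have h1u : 0 < 1 - u := by linarith [(abs_le.1 huabs).2]
  have hlog : Real.log x - Real.log x' = -Real.log (1 - u) := by
    rw [hx'eq, Real.log_mul hxpos.ne' h1u.ne']; ring
  -- `|−log(1−u) − u| ≤ 2u² ≤ (m²/2)/x²`
  have hphi := Literature.NumberTheory.LFunctions.EulerProductOne.abs_neg_log_one_sub_sub_le huabs
  have hu2 : 2 * u ^ 2 ≤ (m ^ 2 / 2) / x ^ 2 := by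
    rw [hu_def, div_pow, le_div_iff₀ (by positivity)]
    have : 2 * (d ^ 2 / x ^ 2) * x ^ 2 = 2 * d ^ 2 := by field_simp
    rw [this]
    have hd2 : d ^ 2 ≤ (m / 2) ^ 2 := by
      rw [← sq_abs]; exact pow_le_pow_left₀ (abs_nonneg d) hdabs 2
    nlinarith
  -- `|u − a/x| = |d − a|/x ≤ (κa/x + r)/x ≤ κa/x² + r/m`
  have hua : |u - a / x| ≤ κ * a / x ^ 2 + r / m := by
    have h1 : u - a / x = (d - a) / x := by rw [hu_def]; field_simp
    rw [h1, abs_div, abs_of_pos hxpos]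
    have h2 : |d - a| ≤ κ * a / x + r := by
      have h3 : d - a = (d - (a + κ * a / x)) + κ * a / x := by ring
      rw [h3]
      exact (abs_add_le _ _).trans (by rw [abs_of_nonneg hκax0]; linarith)
    calc |d - a| / x ≤ (κ * a / x + r) / x := div_le_div_of_nonneg_right h2 hxpos.le
      _ = κ * a / x ^ 2 + r / x := by field_simp
      _ ≤ κ * a / x ^ 2 + r / m := by
          have : r / x ≤ r / m := div_le_div_of_nonneg_left hr hmpos hx
          linarith
  -- assemble
  have hsplit : Real.log x - Real.log x' - a / x = (-Real.log (1 - u) - u) + (u - a / x) := by rw [hlog]; ring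
  rw [hsplit]
  calc |(-Real.log (1 - u) - u) + (u - a / x)| ≤ |-Real.log (1 - u) - u| + |u - a / x| := abs_add_le _ _
    _ ≤ 2 * u ^ 2 + (κ * a / x ^ 2 + r / m) := add_le_add hphi hua
    _ ≤ (m ^ 2 / 2) / x ^ 2 + (κ * a / x ^ 2 + r / m) := by linarith
    _ = (κ * a + m ^ 2 / 2) / x ^ 2 + r / m := by field_simp; ring

/-- ★ §2 **`|log(x_0/x_K) − Σ_{j<K} a/x_j| ≤ C₂`**, `C₂ = (κa + m²/2)(1/m + 2R/m²)/a + R/m`, along the two-loop flow (TL) with floor `x_j ≥ m ≥ 1` and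
`a + κa + R ≤ m/2`. [folklore] -/
theorem abs_log_ratio_sub_sum_le {x e : ℕ → ℝ} {a κ m R : ℝ} {K : ℕ} (ha : 0 < a) (hκ : 0 ≤ κ) (hm : 1 ≤ m)
    (hR : ∑ j ∈ Finset.range K, |e j| ≤ R) (hsmall : a + κ * a + R ≤ m / 2)
    (hx : ∀ j, j ≤ K → m ≤ x j) (hflow : ∀ j, j < K → x j - x (j + 1) = a + κ * a / x j + e j) :
    |Real.log (x 0 / x K) - ∑ j ∈ Finset.range K, a / x j| ≤
      (κ * a + m ^ 2 / 2) * ((1 / m + 2 * R / m ^ 2) / a) + R / m := by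
  have hmpos : 0 < m := by linarith
  have hRnn : 0 ≤ R := le_trans (Finset.sum_nonneg fun j _ => abs_nonneg (e j)) hR
  have hej : ∀ j, j < K → |e j| ≤ R := fun j hj =>
    (Finset.single_le_sum (f := fun j => |e j|) (fun i _ => abs_nonneg _) (Finset.mem_range.2 hj)).trans hR
  -- per-step log estimate
  have hstep : ∀ j ∈ Finset.range K,
      |Real.log (x j) - Real.log (x (j + 1)) - a / x j| ≤ (κ * a + m ^ 2 / 2) / x j ^ 2 + |e j| / m := by
    intro j hj
    have hj' := Finset.mem_range.1 hj
    refine log_step ha hκ hm (abs_nonneg _) (hx j hj'.le) (hx (j + 1) hj') ?_ ?_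
    · have := hej j hj'
      have hκa : 0 ≤ κ * a := by positivity
      linarith
    · rw [hflow j hj']; ring_nf; simp
  -- the `1/x²` budget (§1) from the one-sided decrements
  have hd : ∀ j, j < K → a - |e j| ≤ x j - x (j + 1) := by
    intro j hj
    rw [hflow j hj]
    have h1 : 0 ≤ κ * a / x j := by
      have : 0 < x j := lt_of_lt_of_le hmpos (hx j hj.le)
      positivity
    linarith [neg_abs_le (e j)]
  have hS := inv_sq_sum_le (r := fun j => |e j|) ha hmpos (fun j _ => abs_nonneg _) hR hx hd
  -- sum the steps and telescope
  have hsum : |∑ j ∈ Finset.range K, (Real.log (x j) - Real.log (x (j + 1)) - a / x j)| ≤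
      ∑ j ∈ Finset.range K, ((κ * a + m ^ 2 / 2) / x j ^ 2 + |e j| / m) :=
    (Finset.abs_sum_le_sum_abs _ _).trans (Finset.sum_le_sum hstep)
  have htel : ∑ j ∈ Finset.range K, (Real.log (x j) - Real.log (x (j + 1)) - a / x j) =
      Real.log (x 0 / x K) - ∑ j ∈ Finset.range K, a / x j := by
    rw [Finset.sum_sub_distrib]
    have h1 : ∑ j ∈ Finset.range K, (Real.log (x j) - Real.log (x (j + 1))) = Real.log (x 0) - Real.log (x K) :=
      Finset.sum_range_sub' (fun j => Real.log (x j)) K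
    have hx0 : 0 < x 0 := lt_of_lt_of_le hmpos (hx 0 (Nat.zero_le _))
    have hxK : 0 < x K := lt_of_lt_of_le hmpos (hx K le_rfl)
    rw [h1, Real.log_div hx0.ne' hxK.ne']
  rw [htel] at hsum
  refine hsum.trans ?_
  rw [Finset.sum_add_distrib]
  have h2 : ∑ j ∈ Finset.range K, (κ * a + m ^ 2 / 2) / x j ^ 2 = (κ * a + m ^ 2 / 2) * ∑ j ∈ Finset.range K, 1 / x j ^ 2 := by
    rw [Finset.mul_sum]; refine Finset.sum_congr rfl fun j _ => ?_; ring
  have h3 : ∑ j ∈ Finset.range K, |e j| / m = (∑ j ∈ Finset.range K, |e j|) / m := by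
    rw [Finset.sum_div]
  rw [h2, h3]
  have hc : 0 ≤ κ * a + m ^ 2 / 2 := by positivity
  exact add_le_add (mul_le_mul_of_nonneg_left hS hc) (div_le_div_of_nonneg_right hR hmpos.le)

/-! ## §3 ★ The endpoint of a two-loop flow -/

/-- ★ §3 **Two-loop endpoint.**  Along (TL) `x_j − x_{j+1} = a + κa/x_j + e_j` (`j < K`), `Σ|e_j| ≤ R`, floor `x_j ≥ m ≥ 1`, `a + κa + R ≤ m/2`:
`|x_K − (x_0 − aK − κ log(x_0/x_K))| ≤ κ·C₂ + R`.  (The one-loop line `x_0 − aK` corrected by the two-loop logarithm, up to `O(1)` UNIFORMLY IN `K`.)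
[cite: Rivasseau1991, Lemma II.5.4] -/
theorem twoLoopFlow_endpoint {x e : ℕ → ℝ} {a κ m R : ℝ} {K : ℕ} (ha : 0 < a) (hκ : 0 ≤ κ) (hm : 1 ≤ m)
    (hR : ∑ j ∈ Finset.range K, |e j| ≤ R) (hsmall : a + κ * a + R ≤ m / 2)
    (hx : ∀ j, j ≤ K → m ≤ x j) (hflow : ∀ j, j < K → x j - x (j + 1) = a + κ * a / x j + e j) :
    |x K - (x 0 - a * K - κ * Real.log (x 0 / x K))| ≤
      κ * ((κ * a + m ^ 2 / 2) * ((1 / m + 2 * R / m ^ 2) / a) + R / m) + R := by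
  have hC := abs_log_ratio_sub_sum_le ha hκ hm hR hsmall hx hflow
  -- telescope the flow: `x_0 − x_K = aK + κ Σ a/x_j + Σ e_j`
  have htel : x 0 - x K = a * K + κ * ∑ j ∈ Finset.range K, a / x j + ∑ j ∈ Finset.range K, e j := by
    have h1 : ∑ j ∈ Finset.range K, (x j - x (j + 1)) = x 0 - x K := Finset.sum_range_sub' (fun j => x j) K
    have h2 : ∑ j ∈ Finset.range K, (x j - x (j + 1)) = ∑ j ∈ Finset.range K, (a + κ * a / x j + e j) :=
      Finset.sum_congr rfl fun j hj => hflow j (Finset.mem_range.1 hj)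
    have hA : ∑ j ∈ Finset.range K, (a + κ * a / x j + e j) =
        ∑ j ∈ Finset.range K, a + ∑ j ∈ Finset.range K, κ * a / x j + ∑ j ∈ Finset.range K, e j := by
      rw [← Finset.sum_add_distrib, ← Finset.sum_add_distrib]
    have hB : ∑ j ∈ Finset.range K, a = a * K := by
      rw [Finset.sum_const, Finset.card_range, nsmul_eq_mul, mul_comm]
    have hC : ∑ j ∈ Finset.range K, κ * a / x j = κ * ∑ j ∈ Finset.range K, a / x j := by
      rw [Finset.mul_sum]; exact Finset.sum_congr rfl (fun j _ => by ring)
    linarith [h1, h2, hA, hB, hC]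
  have hsumE : |∑ j ∈ Finset.range K, e j| ≤ R := (Finset.abs_sum_le_sum_abs _ _).trans hR
  have hkey : x K - (x 0 - a * K - κ * Real.log (x 0 / x K)) =
      κ * (Real.log (x 0 / x K) - ∑ j ∈ Finset.range K, a / x j) - ∑ j ∈ Finset.range K, e j := by
    linarith [htel]
  rw [hkey]
  calc |κ * (Real.log (x 0 / x K) - ∑ j ∈ Finset.range K, a / x j) - ∑ j ∈ Finset.range K, e j|
      ≤ |κ * (Real.log (x 0 / x K) - ∑ j ∈ Finset.range K, a / x j)| + |∑ j ∈ Finset.range K, e j| := abs_sub _ _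
    _ ≤ κ * ((κ * a + m ^ 2 / 2) * ((1 / m + 2 * R / m ^ 2) / a) + R / m) + R := by
        rw [abs_mul, abs_of_nonneg hκ]
        exact add_le_add (mul_le_mul_of_nonneg_left hC hκ) hsumE

end TowerFlow

end Summit.QuantumFields.YangMills.Theorems.FemtoTransferGap.TwoLattice

end
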